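import Literature.Analysis.FluidPDE.TsaiProfileEndgame
import HarnessLib

/-!
# Route CorkscrewDynamo · crux `CorkscrewProfile` (stmt-NavierStokesRegularity-11282) — tool stub T2: the pressure Poisson equation `ΔP = −tr (DU ∘ DU)` of a rotated Leray profile

Tool stub `stub_rotatedPressurePoisson` of line `registered` (skeleton v10, lead c5): for a smooth
solution `(U, P)` of the rotated Leray profile system
`−νΔU + aU + aDU[y] + (A U − DU[A y]) + DU[U] + ∇P = 0`, `div U = 0`, on a finite-dimensional real
inner product space `E` (`A : E →L[ℝ] E` an arbitrary continuous linear map; on `ℝ³`,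
`A = α·(e₃ × ·)`), the divergence of the system is the pressure Poisson equation
`ΔP = −tr (DU ∘ DU)`, exactly as for Leray's system (`IsLerayProfile.laplacian_pressure_eq`,
Tsai 1998, (2.1)): the extra rotation forcing `A U − DU[A ·]` is divergence free when `div U = 0`
(Pineau–Vicol 2026, proof of Lemma 2.1), since `div (A ∘ U) = tr (A ∘ DU)`,
`div (y ↦ DU(y) (A y)) = tr (DU ∘ A) + D(div U)[A y] = tr (DU ∘ A)` and `tr (A ∘ DU) = tr (DU ∘ A)`;
no skewness of `A` is used.
-/

noncomputable section

open MeasureTheory Set Function Filter Topology InnerProductSpace Metric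
open Literature.Analysis.FluidPDE
open scoped RealInnerProductSpace Laplacian ContDiff NNReal ENNReal

namespace Summit.NavierStokesRegularity.NavierStokesRegularity.Theorems.CorkscrewProfile.Birth

set_option linter.dupNamespace false

variable {E : Type*} [NormedAddCommGroup E] [InnerProductSpace ℝ E] [FiniteDimensional ℝ E]

/-- The trace is cyclic on continuous linear endomorphisms: `tr (A ∘ L) = tr (L ∘ A)`. [folklore] -/
private theorem traceCLM_comp_comm (A L : E →L[ℝ] E) :
    traceCLM (A.comp L) = traceCLM (L.comp A) := by
  rw [traceCLM_apply, traceCLM_apply, ContinuousLinearMap.toLinearMap_comp,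
    ContinuousLinearMap.toLinearMap_comp, ← Module.End.mul_eq_comp, LinearMap.trace_mul_comm,
    Module.End.mul_eq_comp]

omit [FiniteDimensional ℝ E] in
/-- Chain rule: `D(A ∘ U)(y) = A ∘ DU(y)` for a continuous linear `A`. [folklore] -/
private theorem hasFDerivAt_clm_comp_field {U : E → E} (A : E →L[ℝ] E)
    (hUd : Differentiable ℝ U) (y : E) :
    HasFDerivAt (fun x => A (U x)) (A.comp (fderiv ℝ U y)) y :=
  A.hasFDerivAt.comp y (hUd y).hasFDerivAt

/-- `div (A ∘ U)(y) = tr (A ∘ DU(y))` for a differentiable field `U` and a continuous linear `A`.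
[folklore] -/
private theorem divergence_clm_comp_field {U : E → E} (A : E →L[ℝ] E)
    (hUd : Differentiable ℝ U) (y : E) :
    VectorCalculus.divergence (fun x => A (U x)) y = traceCLM (A.comp (fderiv ℝ U y)) := by
  rw [divergence_eq_traceCLM, (hasFDerivAt_clm_comp_field A hUd y).fderiv]

/-- **`div (y ↦ DU(y) (A y)) = tr (DU ∘ A)` for a divergence-free `C²` field** (the other term,
`D(div U)(y)[A y]`, vanishes by the symmetry of second derivatives). [folklore] -/
private theorem divergence_fderiv_apply_clm_eq {U : E → E} (A : E →L[ℝ] E) (hU : ContDiff ℝ 2 U)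
    (hdiv : VectorCalculus.IsDivFree U) (y : E) :
    VectorCalculus.divergence (fun x => fderiv ℝ U x (A x)) y = traceCLM ((fderiv ℝ U y).comp A) := by
  have hDUd : Differentiable ℝ (fderiv ℝ U) :=
    (hU.fderiv_right (m := 1) le_rfl).differentiable one_ne_zero
  have hdiv0 : VectorCalculus.divergence U = fun _ => (0 : ℝ) := funext hdiv
  rw [divergence_eq_traceCLM, fderiv_clm_apply (hDUd y) A.differentiableAt, map_add,
    A.fderiv]
  have hsymm : traceCLM ((fderiv ℝ (fderiv ℝ U) y).flip (A y)) =
      fderiv ℝ (VectorCalculus.divergence U) y (A y) := by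
    rw [fderiv_divergence_apply hU]
    congr 1
    ext u
    simp only [ContinuousLinearMap.flip_apply]
    exact (hU.contDiffAt.isSymmSndFDerivAt (n := 2) (by simp)) u (A y)
  rw [hsymm, hdiv0]
  simp

/-- **The rotation forcing `A U − DU[A ·]` is divergence free when `div U = 0`**:
`div (A U − DU[A ·]) = tr (A ∘ DU) − tr (DU ∘ A) = 0`; no skewness of `A` is needed.
[cite: PineauVicol2026, proof of Lemma 2.1] -/
private theorem divergence_rotationForcing_eq_zero {U : E → E} (A : E →L[ℝ] E)
    (hU : ContDiff ℝ 2 U) (hdiv : VectorCalculus.IsDivFree U) (y : E) :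
    VectorCalculus.divergence (fun x => A (U x) - fderiv ℝ U x (A x)) y = 0 := by
  have hUd : Differentiable ℝ U := (hU.of_le (by norm_num)).differentiable one_ne_zero
  have hDUd : Differentiable ℝ (fderiv ℝ U) :=
    (hU.fderiv_right (m := 1) le_rfl).differentiable one_ne_zero
  have hd1 : DifferentiableAt ℝ (fun x => A (U x)) y :=
    (hasFDerivAt_clm_comp_field A hUd y).differentiableAt
  have hd2 : DifferentiableAt ℝ (fun x => fderiv ℝ U x (A x)) y :=
    (hDUd y).clm_apply A.differentiableAt
  rw [divergence_sub_apply hd1 hd2, divergence_clm_comp_field A hUd,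
    divergence_fderiv_apply_clm_eq A hU hdiv, traceCLM_comp_comm, sub_self]

/-- **The pressure Poisson equation of a rotated Leray profile**: for a smooth solution `(U, P)`
of `−νΔU + aU + aDU[y] + (A U − DU[A y]) + DU[U] + ∇P = 0`, `div U = 0` (`U ∈ C³`, `P ∈ C²`),
`ΔP = −tr (DU ∘ DU)`. Take the divergence of the system: `div ∇P = ΔP`, `div ΔU = 0`,
`div U = 0`, `div (y ↦ DU(y) y) = 0`, `div ((U·∇)U) = tr (DU ∘ DU)` (Tsai 1998, (2.1)), and the
rotation forcing `A U − DU[A ·]` is divergence free (Pineau–Vicol 2026, proof of Lemma 2.1).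
[cite: Tsai1998, (2.1) (p. 34)] -/
theorem stub_rotatedPressurePoisson {ν a : ℝ} {U : E → E} {P : E → ℝ} (A : E →L[ℝ] E)
    (hU3 : ContDiff ℝ 3 U) (hP2 : ContDiff ℝ 2 P) (hdiv : VectorCalculus.IsDivFree U)
    (heq : ∀ y, -(ν • (Δ U) y) + a • U y + a • fderiv ℝ U y y + (A (U y) - fderiv ℝ U y (A y)) +
      convect U U y + gradient P y = 0)
    (y : E) : (Δ P) y = -traceCLM ((fderiv ℝ U y).comp (fderiv ℝ U y)) := by
  have hU2 : ContDiff ℝ 2 U := hU3.of_le (by norm_num)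
  have hU1 : ContDiff ℝ 1 U := hU3.of_le (by norm_num)
  have hUd : Differentiable ℝ U := hU1.differentiable one_ne_zero
  have hDUd : Differentiable ℝ (fderiv ℝ U) :=
    (hU2.fderiv_right (m := 1) le_rfl).differentiable one_ne_zero
  have hgradP : gradient P = fun x => ν • (Δ U) x - a • U x - a • fderiv ℝ U x x - convect U U x -
      (A (U x) - fderiv ℝ U x (A x)) := by
    funext x
    have hx := heq x
    rw [← sub_eq_zero, ← hx]
    abel
  rw [← divergence_gradient hP2 y, hgradP]
  have hdA : DifferentiableAt ℝ (fun x => ν • (Δ U) x) y :=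
    ((differentiable_laplacian hU3) y).const_smul ν
  have hdB : DifferentiableAt ℝ (fun x => a • U x) y := (hUd y).const_smul a
  have hdC' : DifferentiableAt ℝ (fun x => fderiv ℝ U x x) y :=
    (hDUd y).clm_apply differentiableAt_fun_id
  have hdC : DifferentiableAt ℝ (fun x => a • fderiv ℝ U x x) y := hdC'.const_smul a
  have hdD : DifferentiableAt ℝ (convect U U) y := (hDUd y).clm_apply (hUd y)
  have hdE1 : DifferentiableAt ℝ (fun x => A (U x)) y :=
    (hasFDerivAt_clm_comp_field A hUd y).differentiableAt
  have hdE2 : DifferentiableAt ℝ (fun x => fderiv ℝ U x (A x)) y :=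
    (hDUd y).clm_apply A.differentiableAt
  have hdE : DifferentiableAt ℝ (fun x => A (U x) - fderiv ℝ U x (A x)) y := hdE1.sub hdE2
  have hdAB : DifferentiableAt ℝ (fun x => ν • (Δ U) x - a • U x) y := hdA.sub hdB
  have hdABC : DifferentiableAt ℝ (fun x => ν • (Δ U) x - a • U x - a • fderiv ℝ U x x) y :=
    hdAB.sub hdC
  have hdABCD : DifferentiableAt ℝ
      (fun x => ν • (Δ U) x - a • U x - a • fderiv ℝ U x x - convect U U x) y := hdABC.sub hdD
  rw [divergence_sub_apply hdABCD hdE, divergence_sub_apply hdABC hdD, divergence_sub_apply hdAB hdC,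
    divergence_sub_apply hdA hdB, divergence_const_smul_apply ((differentiable_laplacian hU3) y),
    divergence_const_smul_apply (hUd y), divergence_const_smul_apply hdC',
    divergence_laplacian_eq_zero hU3 hdiv, hdiv y,
    divergence_fderiv_apply_self_eq_zero hU2 hdiv, divergence_convect_self_eq hU2 hdiv,
    divergence_rotationForcing_eq_zero A hU2 hdiv]
  ring

end Summit.NavierStokesRegularity.NavierStokesRegularity.Theorems.CorkscrewProfile.Birth
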